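import Summits.KontsevichZagierPeriods.Zeta5Search.Barrier.ConeGammaCuspGermEndpoint

/-!
# ζ(5) search — BARRIER: A JUNCTION VOTE IS INTEGER-LINEAR ON EVERY CLOSED FLIP-ORDER CHAMBER

HONEST FRAMING (cell `pub-zeta5`): systematic search; no irrationality claim unless kernel-certified. MODEL objects
under Brown–Zudilin's (28)+(30) accounting ([BZ22] = arXiv:2210.03391; (28) observed, not proved); nothing here is a
statement about `ζ(5)`, any `γ` of record, the cone's supremum (C2 OPEN) or the VALUE / SIGN of any vote at a named
direction (DATA of the cell); S-E stays CONJECTURED; records in print UNMOVED. Prover P2 g29, item «CONTINUITY AND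
PIECEWISE LINEARITY» (INBOX 2026-08-27), file (3); companion of `ConeGammaCuspGermEndpoint`.

Fix a junction `b ∈ bkpts a T` and a displacement `δ₀`. The flip time of member `k` is `c_k(δ) = −φ_k(δ)/h_k(a)`, a
linear functional of `δ`. Say `δ` is REFINED BY `δ₀` (at `b`) when every strict inequality between member flip times
of `δ` is a strict inequality for `δ₀` (`δ` may have extra ties, but no reversal): the CLOSED FLIP-ORDER CHAMBER (face)
of `δ₀`, a convex cone containing `δ₀` and `ℝ·s(a)`.
* `torusN_line_at_eq_midpoint` — for a strict chain the saving AT `c_i` equals the saving on the cell right of it;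
* `exists_refined_chain` — for `δ` refined by `δ₀` and the canonical strict chain `c` of `δ₀`, the δ-chain
  `m_i = max {c_l(δ) : l member, c_l(δ₀) ≤ c_i} ∪ {−W(δ)}` is weakly increasing from `−W(δ)` to `W(δ)`, passes through
  every member flip time of `δ`, sits at `c_k(δ)` wherever `c` sits at `c_k(δ₀)`, and wherever it MOVES (`m_j < m_{j+1}`)
  the threshold set of `δ` at `m_j` is the threshold set of `δ₀` at `c_j`;
* **`germ_pair_eq_intLinear_of_refines`** — THE CHAMBER THEOREM: there are INTEGERS `J_k` (`k < 28`), supported on the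
  members of `b`, adding up to the orbit jump `𝒩(θ_b + t·s) − 𝒩(θ_b − t·s)`, with the oriented bounds
  `−#(S ∩ F^c) ≤ J_k ≤ #(S ∩ F)` for every `S ⊇ δ₀`'s tie class of `k` (so a simple flip of an `F`-member carries `0` or
  `+1`, of an `F^c`-member `−1` or `0`), such that for EVERY `δ` refined by `δ₀` and every admissible scale `η`:
  `germR(δ)(b) + germL(δ)(b) = Σ_k J_k · φ_k(δ)/h_k(a)` — the junction vote is the restriction of ONE integer-linear
  functional to the closed chamber (`J_k` = the jump of the saving when `k` flips in `δ₀`'s order; the endpoint jump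
  form on the chain `m`, Abel summation against `δ₀`'s jumps).
DESK (DATA, `HOME/pub-zeta5-p2/g29/alg/facelin.py`, exact): `K_b(δ) = Σ_k J_{b,k}φ_k(δ)/h_k` with `δ₀`'s jumps — 0 failures
on 9,036 (junction, δ) pairs inside and on the boundary of the chamber (record/41, flag/60, argmax-120); beyond the first
wall it fails exactly at junctions no longer refined. NOT here: anything about `γ`, C2, S-E, `ζ(5)`.
-/

noncomputable section

open Set MeasureTheory
open scoped Topology

namespace Summit.KontsevichZagierPeriods.Zeta5Search.Barrier.ConeGamma

/-! ### Endpoint values versus cell values on a strict chain -/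

/-- On a STRICT chain through the member flip times, the saving AT `c_i` (`i < n`) equals the saving at the midpoint
of the cell `(c_i, c_{i+1})` (same threshold set). -/
theorem torusN_line_at_eq_midpoint {a : Dir} (hpos : ∀ k, 0 < h28 a k) {T b : ℝ} (hb : b ∈ bkpts a T)
    (δ : Fin 8 → ℝ) {η : ℝ} (hη : 0 < η) (h1 : η * clusterBound a δ < 1) (h2 : η * clusterBound a δ < wallDist a T)
    {n : ℕ} {c : ℕ → ℝ} (hc0 : c 0 = -clusterWidth a δ) (hcn : c n = clusterWidth a δ)
    (hmono : ∀ j < n, c j < c (j + 1))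
    (hflip : ∀ k, (∃ z : ℤ, b * h28 a k = z) → ∃ i ≤ n, c i = -(phiForm δ k / h28 a k))
    {i : ℕ} (hin : i < n) :
    torusN (b • sParam a + η • (c i • sParam a + δ)) =
      torusN (b • sParam a + η • (((c i + c (i + 1)) / 2) • sParam a + δ)) := by
  have hlt : c i < c (i + 1) := hmono i hin
  have hlo : -clusterWidth a δ ≤ c i := by rw [← hc0]; exact chain_mono hmono (Nat.zero_le i) hin.le
  have hhi : c (i + 1) ≤ clusterWidth a δ := by rw [← hcn]; exact chain_mono hmono (Nat.succ_le_of_lt hin) le_rfl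
  refine torusN_line_eq_of_same_thresholds hpos hb δ hη h1 h2 (abs_le.mpr ⟨hlo, by linarith⟩)
    (abs_le.mpr ⟨by linarith, by linarith⟩) fun k hk => ?_
  obtain ⟨i', hi'n, hci'⟩ := hflip k hk
  refine ⟨fun h => by linarith, fun h => ?_⟩
  by_contra hgt
  have hii : i + 1 ≤ i' := by
    by_contra h'
    exact hgt (hci'.ge.trans (chain_mono hmono (by omega : i' ≤ i) hin.le))
  have := chain_mono hmono hii hi'n
  linarith [hci'.le]

/-! ### The refined chain -/

/-- **THE REFINED CHAIN.** Let `c_0 < ⋯ < c_n` be a strict chain from `−W(δ₀)` to `W(δ₀)` through all 28 flip times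
of `δ₀`, and let `δ` be refined by `δ₀` at `b`. Then there is a weakly increasing chain `m_0 ≤ ⋯ ≤ m_n` from `−W(δ)`
to `W(δ)` through every member flip time of `δ` such that: `m_i = c_k(δ)` whenever `c_i = c_k(δ₀)` for a member `k`;
and for `j + 1 < n` with `m_j < m_{j+1}`, every member `l` has `c_l(δ) ≤ m_j ↔ c_l(δ₀) ≤ c_j`. -/
theorem exists_refined_chain {a : Dir} (hpos : ∀ k, 0 < h28 a k) (b : ℝ) (δ₀ δ : Fin 8 → ℝ)
    (href : ∀ k l, (∃ z : ℤ, b * h28 a k = z) → (∃ z : ℤ, b * h28 a l = z) →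
      phiForm δ k / h28 a k < phiForm δ l / h28 a l → phiForm δ₀ k / h28 a k < phiForm δ₀ l / h28 a l)
    {n : ℕ} {c : ℕ → ℝ} (hc0 : c 0 = -clusterWidth a δ₀) (hcn : c n = clusterWidth a δ₀)
    (hmono : ∀ j < n, c j < c (j + 1)) (hall : ∀ k : Fin 28, ∃ i ≤ n, c i = -(phiForm δ₀ k / h28 a k)) :
    ∃ m : ℕ → ℝ, m 0 = -clusterWidth a δ ∧ m n = clusterWidth a δ ∧ (∀ j < n, m j ≤ m (j + 1)) ∧
      (∀ k, (∃ z : ℤ, b * h28 a k = z) → ∃ i ≤ n, m i = -(phiForm δ k / h28 a k)) ∧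
      (∀ i < n, ∀ k, (∃ z : ℤ, b * h28 a k = z) → c i = -(phiForm δ₀ k / h28 a k) →
        m i = -(phiForm δ k / h28 a k)) ∧
      (∀ j, j + 1 < n → m j < m (j + 1) → ∀ l, (∃ z : ℤ, b * h28 a l = z) →
        (-(phiForm δ l / h28 a l) ≤ m j ↔ -(phiForm δ₀ l / h28 a l) ≤ c j)) := by
  classical
  have hW := clusterWidth_pos hpos δ
  have hW₀ := clusterWidth_pos hpos δ₀
  have hn : 0 < n := Nat.pos_of_ne_zero (by rintro rfl; rw [hc0] at hcn; linarith)
  -- refinement in flip-time form: `c_l(δ₀) ≤ c_k(δ₀) ⇒ c_l(δ) ≤ c_k(δ)` for members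
  have hmon : ∀ k l, (∃ z : ℤ, b * h28 a k = z) → (∃ z : ℤ, b * h28 a l = z) →
      -(phiForm δ₀ l / h28 a l) ≤ -(phiForm δ₀ k / h28 a k) → -(phiForm δ l / h28 a l) ≤ -(phiForm δ k / h28 a k) := by
    intro k l hk hl h
    by_contra h'
    have h'' : phiForm δ l / h28 a l < phiForm δ k / h28 a k := by linarith [not_le.mp h']
    have := href l k hl hk h''
    linarith
  -- the sets and the chain
  set A : ℕ → Finset (Fin 28) := fun i =>
    Finset.univ.filter fun l => (∃ z : ℤ, b * h28 a l = z) ∧ -(phiForm δ₀ l / h28 a l) ≤ c i with hA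
  set V : ℕ → Finset ℝ := fun i => insert (-clusterWidth a δ) ((A i).image fun l => -(phiForm δ l / h28 a l)) with hV
  have hVne : ∀ i, (V i).Nonempty := fun i => Finset.insert_nonempty _ _
  set m : ℕ → ℝ := fun i => if i = n then clusterWidth a δ else (V i).max' (hVne i) with hm
  have hmn : m n = clusterWidth a δ := by rw [hm]; simp
  have hmi : ∀ i, i ≠ n → m i = (V i).max' (hVne i) := fun i hi => by rw [hm]; simp [hi]
  -- membership facts
  have hmemA : ∀ i l, l ∈ A i ↔ (∃ z : ℤ, b * h28 a l = z) ∧ -(phiForm δ₀ l / h28 a l) ≤ c i := fun i l => by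
    rw [hA]; simp
  have hmemV : ∀ i v, v ∈ V i ↔ v = -clusterWidth a δ ∨ ∃ l ∈ A i, -(phiForm δ l / h28 a l) = v := fun i v => by
    rw [hV, Finset.mem_insert, Finset.mem_image]
  have hWmem : ∀ i, -clusterWidth a δ ∈ V i := fun i => (hmemV i _).mpr (Or.inl rfl)
  have hflipmem : ∀ i l, (∃ z : ℤ, b * h28 a l = z) → -(phiForm δ₀ l / h28 a l) ≤ c i →
      -(phiForm δ l / h28 a l) ∈ V i := fun i l hl h => (hmemV i _).mpr (Or.inr ⟨l, (hmemA i l).mpr ⟨hl, h⟩, rfl⟩)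
  -- lower and upper bounds of `m i`, `i ≠ n`
  have hmlo : ∀ i, i ≠ n → -clusterWidth a δ ≤ m i := fun i hi => by
    rw [hmi i hi]; exact Finset.le_max' _ _ (hWmem i)
  have hmhi : ∀ i, i ≠ n → m i ≤ clusterWidth a δ := fun i hi => by
    rw [hmi i hi]
    refine Finset.max'_le _ _ _ fun v hv => ?_
    rcases (hmemV i v).mp hv with rfl | ⟨l, -, rfl⟩
    · linarith
    · have := (abs_lt.mp (abs_flip_lt_clusterWidth hpos δ l)).1; linarith
  -- the value at a member index
  have hval : ∀ i, i ≠ n → ∀ k, (∃ z : ℤ, b * h28 a k = z) → c i = -(phiForm δ₀ k / h28 a k) →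
      m i = -(phiForm δ k / h28 a k) := by
    intro i hi k hk hci
    rw [hmi i hi]
    refine le_antisymm (Finset.max'_le _ _ _ fun v hv => ?_) (Finset.le_max' _ _ (hflipmem i k hk hci.ge))
    rcases (hmemV i v).mp hv with rfl | ⟨l, hl, rfl⟩
    · have := (abs_lt.mp (abs_flip_lt_clusterWidth hpos δ k)).2; linarith
    · obtain ⟨hl, hle⟩ := (hmemA i l).mp hl
      exact hmon k l hk hl (hci ▸ hle)
  refine ⟨m, ?_, hmn, fun j hj => ?_, fun k hk => ?_, fun i hi k hk hci => hval i hi.ne k hk hci, fun j hj hlt l hl => ?_⟩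
  · -- `m 0 = −W(δ)`: no member has `c_l(δ₀) ≤ c_0 = −W(δ₀)`
    rw [hmi 0 hn.ne]
    refine le_antisymm (Finset.max'_le _ _ _ fun v hv => ?_) (Finset.le_max' _ _ (hWmem 0))
    rcases (hmemV 0 v).mp hv with rfl | ⟨l, hl, rfl⟩
    · exact le_rfl
    · obtain ⟨-, hle⟩ := (hmemA 0 l).mp hl
      have := (abs_lt.mp (abs_flip_lt_clusterWidth hpos δ₀ l)).2
      rw [hc0] at hle
      linarith
  · -- weakly increasing
    by_cases hjn : j + 1 = n
    · rw [hjn, hmn]; exact hmhi j (by omega)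
    · rw [hmi j (by omega), hmi (j + 1) hjn]
      refine Finset.max'_subset _ fun v hv => ?_
      rcases (hmemV j v).mp hv with rfl | ⟨l, hl, rfl⟩
      · exact hWmem _
      · obtain ⟨hl, hle⟩ := (hmemA j l).mp hl
        exact hflipmem _ l hl (hle.trans (hmono j hj).le)
  · -- through every member flip time of `δ`
    obtain ⟨i, hin, hci⟩ := hall k
    obtain ⟨-, hin'⟩ := flip_index_interior hpos δ₀ hc0 hcn hin hci
    exact ⟨i, hin, hval i hin'.ne k hk hci⟩
  · -- where the chain moves, the threshold sets agree
    have hjn : j ≠ n := by omega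
    have hj1n : j + 1 ≠ n := by omega
    refine ⟨fun hle => ?_, fun hle => by rw [hmi j hjn]; exact Finset.le_max' _ _ (hflipmem j l hl hle)⟩
    by_contra hgt
    push Not at hgt
    -- `m (j+1)` is attained at a member `l'` with `c j < c_{l'}(δ₀) ≤ c (j+1)`
    have hmax := Finset.max'_mem (V (j + 1)) (hVne (j + 1))
    rw [← hmi (j + 1) hj1n] at hmax
    rcases (hmemV (j + 1) _).mp hmax with h | ⟨l', hl', hl'v⟩
    · have := hmlo j hjn; linarith
    · obtain ⟨hl'mem, hl'le⟩ := (hmemA (j + 1) l').mp hl'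
      have hl'gt : c j < -(phiForm δ₀ l' / h28 a l') := by
        by_contra h
        push Not at h
        have : -(phiForm δ l' / h28 a l') ≤ m j := by rw [hmi j hjn]; exact Finset.le_max' _ _ (hflipmem j l' hl'mem h)
        linarith
      -- `c_l(δ₀) > c_j` is a chain value, hence `≥ c_{j+1} ≥ c_{l'}(δ₀)`
      obtain ⟨i', hi'n, hci'⟩ := hall l
      have hii : j + 1 ≤ i' := by
        by_contra h
        have := chain_mono hmono (by omega : i' ≤ j) (by omega)
        linarith [hci'.le]
      have hge : -(phiForm δ₀ l' / h28 a l') ≤ -(phiForm δ₀ l / h28 a l) :=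
        hl'le.trans (hci'.symm ▸ chain_mono hmono hii hi'n)
      have := hmon l l' hl hl'mem hge
      linarith

/-! ### Abel cancellation -/

/-- Abel cancellation: if `X_0 = 0`, `X_{n−1} = 0` and `(m_{j+1} − m_j)·X_j = 0` whenever `j + 1 < n`, then
`Σ_{0<i<n} m_i·(X_i − X_{i−1}) = 0`. -/
theorem sum_mul_sub_eq_zero_of_steps {m X : ℕ → ℝ} {n : ℕ} (hn : 0 < n) (hX0 : X 0 = 0) (hXn : X (n - 1) = 0)
    (hstep : ∀ j, j + 1 < n → (m (j + 1) - m j) * X j = 0) :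
    ∑ i ∈ Finset.Ico 1 n, m i * (X i - X (i - 1)) = 0 := by
  have hA := sum_cells_abel m X hn
  have hL : ∑ j ∈ Finset.range n, (m (j + 1) - m j) * X j = 0 := by
    refine Finset.sum_eq_zero fun j hj => ?_
    have hj := Finset.mem_range.mp hj
    by_cases hjn : j + 1 < n
    · exact hstep j hjn
    · rw [show j = n - 1 by omega, hXn, mul_zero]
  rw [hL, hXn, hX0, mul_zero, mul_zero, sub_zero, add_zero] at hA
  have h : ∑ i ∈ Finset.Ico 1 n, m i * (X i - X (i - 1)) = -∑ i ∈ Finset.Ico 1 n, m i * (X (i - 1) - X i) := by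
    rw [← Finset.sum_neg_distrib]; exact Finset.sum_congr rfl fun i _ => by ring
  rw [h, ← hA, neg_zero]

/-! ### The chamber theorem -/

/-- **A JUNCTION VOTE IS INTEGER-LINEAR ON EVERY CLOSED FLIP-ORDER CHAMBER.** Let all 28 forms of `a` be positive,
`T > 0`, `b ∈ bkpts a T` and `δ₀` any displacement. There are integers `J_k` (`k < 28`) with
(i) `J_k = 0` unless `k` is a member of `b`; (ii) `Σ_k J_k = 𝒩(θ_b + t·s) − 𝒩(θ_b − t·s)` for every line step `t`
(the orbit jump); (iii) `−#(S ∩ F^c) ≤ J_k ≤ #(S ∩ F)` for every finset `S` containing all members `l` with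
`φ_l(δ₀)/h_l = φ_k(δ₀)/h_k` (δ₀'s tie class of `k`); and (iv) for EVERY displacement `δ` REFINED BY `δ₀` at `b`
(`φ_k(δ)/h_k < φ_l(δ)/h_l ⇒ φ_k(δ₀)/h_k < φ_l(δ₀)/h_l` for members `k, l`) and every admissible scale `η`
(`ηK(δ) < 1`, `ηK(δ) < wallDist a T`): `germR(δ)(b) + germL(δ)(b) = Σ_k J_k · φ_k(δ)/h_k(a)`. -/
theorem germ_pair_eq_intLinear_of_refines {a : Dir} (hpos : ∀ k, 0 < h28 a k) {T b : ℝ} (hT : 0 < T)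
    (hb : b ∈ bkpts a T) (δ₀ : Fin 8 → ℝ) :
    ∃ J : Fin 28 → ℤ,
      (∀ k, (∀ z : ℤ, b * h28 a k ≠ z) → J k = 0) ∧
      (∀ t, 0 < t → t * xMax a < 1 → t * xMax a < wallDist a T →
        ∑ k, J k = torusN (b • sParam a + t • sParam a) - torusN (b • sParam a - t • sParam a)) ∧
      (∀ k (S : Finset (Fin 28)),
        (∀ l, (∃ z : ℤ, b * h28 a l = z) → phiForm δ₀ l / h28 a l = phiForm δ₀ k / h28 a k → l ∈ S) →
          -(((S ∩ FIdxᶜ).card : ℤ)) ≤ J k ∧ J k ≤ (S ∩ FIdx).card) ∧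
      ∀ δ : Fin 8 → ℝ,
        (∀ k l, (∃ z : ℤ, b * h28 a k = z) → (∃ z : ℤ, b * h28 a l = z) →
          phiForm δ k / h28 a k < phiForm δ l / h28 a l → phiForm δ₀ k / h28 a k < phiForm δ₀ l / h28 a l) →
        ∀ η, 0 < η → η * clusterBound a δ < 1 → η * clusterBound a δ < wallDist a T →
          germR a δ η b + germL a δ η b = ∑ k, (J k : ℝ) * (phiForm δ k / h28 a k) := by
  classical
  have hW₀ := clusterWidth_pos hpos δ₀
  -- the canonical strict chain of `δ₀` through all 28 flip times
  have hin : ∀ k : Fin 28, -clusterWidth a δ₀ < -(phiForm δ₀ k / h28 a k) ∧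
      -(phiForm δ₀ k / h28 a k) < clusterWidth a δ₀ := fun k => by
    have h := abs_lt.mp (abs_flip_lt_clusterWidth hpos δ₀ k)
    exact ⟨by linarith [h.2], by linarith [h.1]⟩
  obtain ⟨n, c, hc0, hcn, hmono, hmem, -⟩ := exists_chain_through
    (Finset.univ.image fun k : Fin 28 => -(phiForm δ₀ k / h28 a k)) (by linarith : -clusterWidth a δ₀ < clusterWidth a δ₀)
    (fun v hv => by obtain ⟨k, -, rfl⟩ := Finset.mem_image.mp hv; exact (hin k).1)
    (fun v hv => by obtain ⟨k, -, rfl⟩ := Finset.mem_image.mp hv; exact (hin k).2)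
  have hall : ∀ k : Fin 28, ∃ i ≤ n, c i = -(phiForm δ₀ k / h28 a k) := fun k =>
    hmem _ (Finset.mem_image.mpr ⟨k, Finset.mem_univ _, rfl⟩)
  have hmonow : ∀ j < n, c j ≤ c (j + 1) := fun j hj => (hmono j hj).le
  have hflip₀ : ∀ k, (∃ z : ℤ, b * h28 a k = z) → ∃ i ≤ n, c i = -(phiForm δ₀ k / h28 a k) := fun k _ => hall k
  have hn : 0 < n := Nat.pos_of_ne_zero (by rintro rfl; rw [hc0] at hcn; linarith)
  -- an admissible scale for `δ₀` and the endpoint values `F₀ i` of `δ₀` on its chain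
  obtain ⟨η₀, hη₀, h01, h02, -⟩ := exists_admissible_scale hpos hT δ₀
  obtain ⟨F₀, hF₀⟩ : ∃ F₀ : ℕ → ℤ, ∀ i, F₀ i = torusN (b • sParam a + η₀ • (c i • sParam a + δ₀)) :=
    ⟨_, fun i => rfl⟩
  -- the member booked at a chain point
  obtain ⟨κ, hκ_spec⟩ : ∃ κ : ℕ → Fin 28, ∀ i,
      (∃ k : Fin 28, (∃ z : ℤ, b * h28 a k = z) ∧ c i = -(phiForm δ₀ k / h28 a k)) →
        (∃ z : ℤ, b * h28 a (κ i) = z) ∧ c i = -(phiForm δ₀ (κ i) / h28 a (κ i)) :=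
    ⟨fun i => if h : ∃ k : Fin 28, (∃ z : ℤ, b * h28 a k = z) ∧ c i = -(phiForm δ₀ k / h28 a k) then h.choose
      else 0, fun i h => by simp only [dif_pos h]; exact h.choose_spec⟩
  -- a chain point booked on no member carries no jump
  have hjump0 : ∀ i, 0 < i → i < n → (¬ ∃ k : Fin 28, (∃ z : ℤ, b * h28 a k = z) ∧
      c i = -(phiForm δ₀ k / h28 a k)) → F₀ i - F₀ (i - 1) = 0 := by
    intro i hi0 hin h
    rw [hF₀, hF₀, sub_eq_zero]
    exact endpoint_jump_eq_zero_of_no_member hpos hb δ₀ hη₀ h01 h02 hc0 hcn hmonow hflip₀ hi0 hin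
      fun k hk hci => h ⟨k, hk, hci⟩
  -- two chain points booked on the same member coincide
  have hbook : ∀ i i' (k : Fin 28), i < n → i' < n →
      (∃ k' : Fin 28, (∃ z : ℤ, b * h28 a k' = z) ∧ c i = -(phiForm δ₀ k' / h28 a k')) →
      (∃ k' : Fin 28, (∃ z : ℤ, b * h28 a k' = z) ∧ c i' = -(phiForm δ₀ k' / h28 a k')) →
      κ i = k → κ i' = k → i = i' := by
    intro i i' k hin hi'n h h' hκi hκi'
    have e : c i = c i' := by rw [(hκ_spec i h).2, (hκ_spec i' h').2, hκi, hκi']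
    by_contra hne
    rcases lt_or_gt_of_ne hne with hlt | hlt
    · exact absurd e (chain_strictMono hmono hlt hi'n.le).ne
    · exact absurd e.symm (chain_strictMono hmono hlt hin.le).ne
  -- the integer weights
  obtain ⟨J, hJ⟩ : ∃ J : Fin 28 → ℤ, ∀ k,
      J k = ∑ i ∈ (Finset.Ico 1 n).filter (fun i => κ i = k), (F₀ i - F₀ (i - 1)) := ⟨_, fun k => rfl⟩
  refine ⟨J, fun k hk => ?_, fun t ht ht1 ht2 => ?_, fun k S hS => ?_, fun δ href η hη h1 h2 => ?_⟩
  · -- (i) supported on members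
    rw [hJ]
    refine Finset.sum_eq_zero fun i hi => ?_
    obtain ⟨hi, hκi⟩ := Finset.mem_filter.mp hi
    obtain ⟨hi1, hin⟩ := Finset.mem_Ico.mp hi
    refine hjump0 i hi1 hin fun h => ?_
    obtain ⟨z, hz⟩ := (hκ_spec i h).1
    exact hk z (hκi ▸ hz)
  · -- (ii) the weights add up to the orbit jump
    have hfib := Finset.sum_fiberwise (Finset.Ico 1 n) κ fun i => F₀ i - F₀ (i - 1)
    rw [show ∑ k, J k = ∑ k, ∑ i ∈ (Finset.Ico 1 n).filter (fun i => κ i = k), (F₀ i - F₀ (i - 1)) from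
      Finset.sum_congr rfl fun k _ => hJ k, hfib]
    simp_rw [hF₀]
    exact sum_endpoint_jumps hpos hb δ₀ hη₀ h01 h02 ht ht1 ht2 hn hc0 hcn hmonow hflip₀
  · -- (iii) oriented bounds: at most one chain point of the fibre is booked on a member
    rw [hJ]
    by_cases hex : ∃ i ∈ (Finset.Ico 1 n).filter (fun i => κ i = k),
        ∃ k' : Fin 28, (∃ z : ℤ, b * h28 a k' = z) ∧ c i = -(phiForm δ₀ k' / h28 a k')
    · obtain ⟨i₀, hi₀, h₀⟩ := hex
      obtain ⟨hi₀', hκi₀⟩ := Finset.mem_filter.mp hi₀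
      obtain ⟨hi₀1, hi₀n⟩ := Finset.mem_Ico.mp hi₀'
      have hsingle : ∑ i ∈ (Finset.Ico 1 n).filter (fun i => κ i = k), (F₀ i - F₀ (i - 1)) =
          F₀ i₀ - F₀ (i₀ - 1) := by
        refine Finset.sum_eq_single_of_mem i₀ hi₀ fun i hi hne => ?_
        obtain ⟨hi', hκi⟩ := Finset.mem_filter.mp hi
        obtain ⟨hi1, hin⟩ := Finset.mem_Ico.mp hi'
        exact hjump0 i hi1 hin fun h => hne (hbook i i₀ k hin hi₀n h h₀ hκi hκi₀)
      rw [hsingle, hF₀, hF₀]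
      obtain ⟨hκmem, hκc⟩ := hκ_spec i₀ h₀
      rw [hκi₀] at hκc hκmem
      have hg := germ_jump_oriented hpos hb δ₀ hη₀ h01 h02 hc0 hcn hmono hflip₀ hi₀1 hi₀n (S := S)
        fun l hl hcl => hS l hl (by
          have : -(phiForm δ₀ l / h28 a l) = -(phiForm δ₀ k / h28 a k) := hcl.symm.trans hκc
          linarith)
      have e2 := torusN_line_at_eq_midpoint hpos hb δ₀ hη₀ h01 h02 hc0 hcn hmono hflip₀ (i := i₀ - 1) (by omega)
      rw [Nat.sub_add_cancel hi₀1] at e2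
      rw [torusN_line_at_eq_midpoint hpos hb δ₀ hη₀ h01 h02 hc0 hcn hmono hflip₀ hi₀n, e2]
      exact hg
    · have hzero : ∑ i ∈ (Finset.Ico 1 n).filter (fun i => κ i = k), (F₀ i - F₀ (i - 1)) = 0 :=
        Finset.sum_eq_zero fun i hi => by
          obtain ⟨hi', -⟩ := Finset.mem_filter.mp hi
          obtain ⟨hi1, hin⟩ := Finset.mem_Ico.mp hi'
          exact hjump0 i hi1 hin fun h => hex ⟨i, hi, h⟩
      rw [hzero]
      exact ⟨neg_nonpos.mpr (by positivity), by positivity⟩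
  · -- (iv) the vote on the closed chamber
    have hW := clusterWidth_pos hpos δ
    obtain ⟨m, hm0, hmn, hmmono, hmflip, hmval, hmthr⟩ :=
      exists_refined_chain hpos b δ₀ δ href hc0 hcn hmono hall
    rw [germ_pair_eq_sum_endpoint_jumps hpos hb δ hη h1 h2 hm0 hmn hmmono hmflip]
    -- regroup the right-hand side over the chain points
    have hR : ∑ k, (J k : ℝ) * (phiForm δ k / h28 a k) =
        ∑ i ∈ Finset.Ico 1 n, ((F₀ i - F₀ (i - 1) : ℤ) : ℝ) * (phiForm δ (κ i) / h28 a (κ i)) := by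
      rw [← Finset.sum_fiberwise (Finset.Ico 1 n) κ
        (fun i => ((F₀ i - F₀ (i - 1) : ℤ) : ℝ) * (phiForm δ (κ i) / h28 a (κ i)))]
      refine Finset.sum_congr rfl fun k _ => ?_
      rw [hJ, Int.cast_sum, Finset.sum_mul]
      refine Finset.sum_congr rfl fun i hi => ?_
      obtain ⟨-, hκi⟩ := Finset.mem_filter.mp hi
      rw [hκi]
    rw [hR]
    -- termwise: the booked member's flip time for `δ` is `m i`
    have hterm : ∀ i ∈ Finset.Ico 1 n, ((F₀ i - F₀ (i - 1) : ℤ) : ℝ) * (phiForm δ (κ i) / h28 a (κ i)) =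
        -(m i * ((F₀ i : ℝ) - F₀ (i - 1))) := by
      intro i hi
      obtain ⟨hi1, hin⟩ := Finset.mem_Ico.mp hi
      by_cases h : ∃ k : Fin 28, (∃ z : ℤ, b * h28 a k = z) ∧ c i = -(phiForm δ₀ k / h28 a k)
      · obtain ⟨hκmem, hκc⟩ := hκ_spec i h
        rw [hmval i hin (κ i) hκmem hκc]
        push_cast
        ring
      · rw [hjump0 i hi1 hin h, (sub_eq_zero.mp (hjump0 i hi1 hin h))]
        push_cast
        ring
    rw [Finset.sum_congr rfl hterm, Finset.sum_neg_distrib, neg_inj, ← sub_eq_zero, ← Finset.sum_sub_distrib]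
    -- Abel cancellation against `δ₀`'s endpoint values
    obtain ⟨ht, ht1, ht2⟩ := lineStep_small hpos (T := T) δ hη h1 h2 hW le_rfl
    have hX0 : (torusN (b • sParam a + η • (m 0 • sParam a + δ)) : ℝ) - F₀ 0 = 0 := by
      rw [sub_eq_zero, hF₀, hm0, hc0, torusN_line_at_first hpos hb δ hη h1 h2 ht ht1 ht2,
        torusN_line_at_first hpos hb δ₀ hη₀ h01 h02 ht ht1 ht2]
    have hXn : (torusN (b • sParam a + η • (m (n - 1) • sParam a + δ)) : ℝ) - F₀ (n - 1) = 0 := by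
      rw [sub_eq_zero, hF₀, torusN_line_at_last hpos hb δ hη h1 h2 ht ht1 ht2 hn hm0 hmn hmmono hmflip,
        torusN_line_at_last hpos hb δ₀ hη₀ h01 h02 ht ht1 ht2 hn hc0 hcn hmonow hflip₀]
    have hstep : ∀ j, j + 1 < n →
        (m (j + 1) - m j) * ((torusN (b • sParam a + η • (m j • sParam a + δ)) : ℝ) - F₀ j) = 0 := by
      intro j hj
      rcases (hmmono j (by omega)).eq_or_lt with heq | hlt
      · rw [heq, sub_self, zero_mul]
      · rw [hF₀, mul_eq_zero]; right; rw [sub_eq_zero]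
        obtain ⟨hx1, hx2⟩ := disp_small hpos δ hη h1 h2 (abs_wchain_le hm0 hmn hmmono (by omega : j ≤ n)) (T := T)
        obtain ⟨hy1, hy2⟩ := disp_small hpos δ₀ hη₀ h01 h02 (abs_wchain_le hc0 hcn hmonow (by omega : j ≤ n)) (T := T)
        exact_mod_cast torusN_eq_of_member_weakSigns hb hx1 hx2 hy1 hy2 fun l hl => by
          have hl0 := hpos l
          rw [phiForm_disp, phiForm_disp, line_form_eq_mul_sub hl0 rfl, line_form_eq_mul_sub hl0 rfl]
          by_cases hle : -(phiForm δ l / h28 a l) ≤ m j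
          · exact Or.inl ⟨mul_nonneg hη.le (mul_nonneg hl0.le (sub_nonneg.mpr hle)),
              mul_nonneg hη₀.le (mul_nonneg hl0.le (sub_nonneg.mpr ((hmthr j hj hlt l hl).mp hle)))⟩
          · have hle' : ¬ -(phiForm δ₀ l / h28 a l) ≤ c j := fun h => hle ((hmthr j hj hlt l hl).mpr h)
            exact Or.inr ⟨mul_neg_of_pos_of_neg hη (mul_neg_of_pos_of_neg hl0 (sub_neg.mpr (lt_of_not_ge hle))),
              mul_neg_of_pos_of_neg hη₀ (mul_neg_of_pos_of_neg hl0 (sub_neg.mpr (lt_of_not_ge hle')))⟩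
    have key := sum_mul_sub_eq_zero_of_steps (m := m)
      (X := fun i => (torusN (b • sParam a + η • (m i • sParam a + δ)) : ℝ) - F₀ i) hn hX0 hXn hstep
    rw [← key]
    refine Finset.sum_congr rfl fun i _ => ?_
    ring

end Summit.KontsevichZagierPeriods.Zeta5Search.Barrier.ConeGamma

end
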